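import Mathlib.LinearAlgebra.Trace
import Mathlib.Tactic.NoncommRing
import Mathlib.LinearAlgebra.Projection
import Mathlib.LinearAlgebra.Basis.VectorSpace
import Mathlib.LinearAlgebra.FiniteDimensional.Lemmas
import Mathlib.LinearAlgebra.PID
import Mathlib.LinearAlgebra.StdBasis
import HarnessLib

/-!
# Trace tools for the SUPPLY stub of crux 23422 (line `cartan` v11): block traces, kernel ∕ range additivity,
# descent by a complement-swapping automorphism, and the trace of a permutation operator

Helper file `--supports stmt-BirchSwinnertonDyer-23422` (seat `bsd-stepL-tam3-p1` g23, LINE OWNER of crux 23422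
`EulerHalvesAtThreeResidualUpperBound`). It serves the registered stub (SUPPLY) `stub_cartanTorusLatticeSupply :
CartanCorrespondence.CartanTorusLatticeSupply` through the road of `HOME/tam3-p1/g23/SUPPLY-ROAD-GG1.md`: there the
character identity `trace_eq` of a Cartan torus lattice is obtained as a DIFFERENCE OF PERMUTATION CHARACTERS along
kernels of equivariant maps between permutation modules (`V₁ = ker(ℤ[C] → ℤ[ℙ¹])`, `GG₁ = ker(ℤ[pairs] → ℤ[ℙ¹])`),
halved by a DESCENT along an automorphism swapping two complementary `G`-stable subspaces (`R − R²` on the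
`T`-eigenspaces, resp. the deck involution), and finally read off from FIXED-POINT COUNTS. This file supplies the four
pieces of pure linear algebra over a field `K` (used with `K = ℚ`):
* `trace_eq_trace_block_add_trace_block` : `tr f = tr(π f π) + tr((1−π) f (1−π))` for an idempotent `π` (no invariance needed);
* `trace_block_eq_trace_restrict` : if `f(p) ⊆ p` then `tr(π f π) = tr(f|p)` for the projection `π` onto `p` along a complement;
* `trace_eq_trace_restrict_ker_add_trace_restrict_range` : for `f : V → W` intertwining `gV` and `gW`,
  `tr gV = tr(gV | ker f) + tr(gW | range f)`;
* `trace_eq_two_mul_trace_restrict_of_isCompl_map` : if `φ` commutes with `g`, `g(U) ⊆ U` and `V = U ⊕ φ(U)`, then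
  `tr g = 2·tr(g|U)`;
* `trace_funLeft_perm` : the operator `v ↦ v ∘ τ` on `X → K` has trace the number of fixed points of the permutation `τ`.
HONEST FRAMING: generic linear algebra only; nothing about `GL₂(𝔽_q)`, SUPPLY, NUM, crux 23422 ∕ 19109 is proved here; BSD is proved for no curve. [folklore]
-/

set_option linter.dupNamespace false
set_option autoImplicit false

namespace Summit.BirchSwinnertonDyer.BirchSwinnertonDyer.Theorems.CartanSupply.TraceTools

open Module LinearMap

section Field

variable {K : Type*} [Field K] {V W : Type*} [AddCommGroup V] [Module K V] [FiniteDimensional K V]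
  [AddCommGroup W] [Module K W] [FiniteDimensional K W]

/-! ## §1 Block traces for an idempotent -/

omit [FiniteDimensional K V] in
/-- PROVED: for an idempotent `π` the "off-diagonal blocks" have trace zero, so
`tr f = tr(π f π) + tr((1−π) f (1−π))` — no invariance of anything is needed. [folklore] -/
theorem trace_eq_trace_block_add_trace_block (π f : Module.End K V) (hπ : IsIdempotentElem π) :
    LinearMap.trace K V f =
      LinearMap.trace K V (π * f * π) + LinearMap.trace K V ((1 - π) * f * (1 - π)) := by
  have h1 : (1 - π) * π = 0 := by rw [sub_mul, one_mul, hπ.eq, sub_self]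
  have h2 : π * (1 - π) = 0 := by rw [mul_sub, mul_one, hπ.eq, sub_self]
  have hoff₁ : LinearMap.trace K V (π * f * (1 - π)) = 0 := by
    rw [mul_assoc, LinearMap.trace_mul_comm, mul_assoc, h1, mul_zero, map_zero]
  have hoff₂ : LinearMap.trace K V ((1 - π) * f * π) = 0 := by
    rw [mul_assoc, LinearMap.trace_mul_comm, mul_assoc, h2, mul_zero, map_zero]
  have hsum : f = π * f * π + π * f * (1 - π) + ((1 - π) * f * π + (1 - π) * f * (1 - π)) := by
    noncomm_ring
  conv_lhs => rw [hsum]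
  rw [map_add, map_add, map_add, hoff₁, hoff₂, add_zero, zero_add]

/-- PROVED: if `f` preserves `p`, the `p`-block of `f` for the projection `π` onto `p` along a complement `q` has trace
`tr(f|p)`. [folklore] -/
theorem trace_block_eq_trace_restrict {p q : Submodule K V} (hpq : IsCompl p q) (f : Module.End K V)
    (hf : ∀ x ∈ p, f x ∈ p) :
    LinearMap.trace K V (p.projection q hpq * f * p.projection q hpq) = LinearMap.trace K p (f.restrict hf) := by
  set g : Module.End K V := p.projection q hpq * f * p.projection q hpq with hg
  have hgp : ∀ x, g x ∈ p := fun x => by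
    rw [hg, Module.End.mul_apply, Module.End.mul_apply]
    exact Submodule.projection_apply_mem hpq _
  have hgp' : ∀ x ∈ p, g x ∈ p := fun x _ => hgp x
  rw [← LinearMap.trace_restrict_eq_of_forall_mem p g hgp hgp']
  congr 1
  apply LinearMap.ext
  intro x
  apply Subtype.ext
  rw [LinearMap.coe_restrict_apply, LinearMap.coe_restrict_apply, hg, Module.End.mul_apply, Module.End.mul_apply,
    Submodule.projection_apply_left hpq x, Submodule.projection_apply_of_mem_left hpq (hf x x.2)]

/-- PROVED: the complementary block, restricted to the complement `q`, is `π_q ∘ f` on `q`. Its trace on `V` equals its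
trace on `q`. [folklore] -/
theorem trace_coblock_eq_trace_restrict {p q : Submodule K V} (hpq : IsCompl p q) (f : Module.End K V) :
    LinearMap.trace K V (q.projection p hpq.symm * f * q.projection p hpq.symm) =
      LinearMap.trace K q ((q.projection p hpq.symm * f * q.projection p hpq.symm).restrict
        (fun _ _ => Submodule.projection_apply_mem hpq.symm _)) :=
  (LinearMap.trace_restrict_eq_of_forall_mem q (q.projection p hpq.symm * f * q.projection p hpq.symm)
    (fun _ => Submodule.projection_apply_mem hpq.symm _) _).symm

/-! ## §2 Kernel ∕ range additivity of the trace along an intertwining map -/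

omit [FiniteDimensional K V] [FiniteDimensional K W] in
/-- PROVED: an intertwiner maps `gV`-stably: `gV (ker f) ⊆ ker f`. [folklore] -/
theorem mapsTo_ker_of_comp_eq (f : V →ₗ[K] W) (gV : Module.End K V) (gW : Module.End K W)
    (hc : f ∘ₗ gV = gW ∘ₗ f) : ∀ x ∈ LinearMap.ker f, gV x ∈ LinearMap.ker f := by
  intro x hx
  rw [LinearMap.mem_ker] at hx ⊢
  have := congrArg (fun h : V →ₗ[K] W => h x) hc
  simp only [LinearMap.coe_comp, Function.comp_apply] at this
  rw [this, hx, map_zero]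

omit [FiniteDimensional K V] [FiniteDimensional K W] in
/-- PROVED: `gW (range f) ⊆ range f`. [folklore] -/
theorem mapsTo_range_of_comp_eq (f : V →ₗ[K] W) (gV : Module.End K V) (gW : Module.End K W)
    (hc : f ∘ₗ gV = gW ∘ₗ f) : ∀ y ∈ LinearMap.range f, gW y ∈ LinearMap.range f := by
  rintro y ⟨x, rfl⟩
  refine ⟨gV x, ?_⟩
  have := congrArg (fun h : V →ₗ[K] W => h x) hc
  simpa only [LinearMap.coe_comp, Function.comp_apply] using this

omit [FiniteDimensional K W] in
/-- PROVED — **TRACE ADDITIVITY ALONG AN INTERTWINER**: if `f ∘ gV = gW ∘ f` then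
`tr gV = tr(gV | ker f) + tr(gW | range f)` (rank–nullity with traces: a complement `q` of `ker f` maps isomorphically
onto `range f`, conjugating the `q`-block of `gV` to `gW|range f`). [folklore] -/
theorem trace_eq_trace_restrict_ker_add_trace_restrict_range (f : V →ₗ[K] W) (gV : Module.End K V)
    (gW : Module.End K W) (hc : f ∘ₗ gV = gW ∘ₗ f) :
    LinearMap.trace K V gV =
      LinearMap.trace K (LinearMap.ker f) (gV.restrict (mapsTo_ker_of_comp_eq f gV gW hc)) +
        LinearMap.trace K (LinearMap.range f) (gW.restrict (mapsTo_range_of_comp_eq f gV gW hc)) := by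
  set p : Submodule K V := LinearMap.ker f with hp
  obtain ⟨q, hpq⟩ := p.exists_isCompl
  have hcx : ∀ x, f (gV x) = gW (f x) := fun x => by
    have := congrArg (fun h : V →ₗ[K] W => h x) hc
    simpa only [LinearMap.coe_comp, Function.comp_apply] using this
  -- block decomposition for the projection onto `p = ker f` along `q`
  have hidem := Submodule.isIdempotentElem_projection hpq
  rw [trace_eq_trace_block_add_trace_block (p.projection q hpq) gV hidem,
    trace_block_eq_trace_restrict hpq gV (mapsTo_ker_of_comp_eq f gV gW hc)]
  congr 1
  -- the complementary block: `1 - π_p = π_q`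
  rw [Module.End.one_eq_id, ← Submodule.projection_eq_id_sub_projection hpq, trace_coblock_eq_trace_restrict hpq gV]
  -- `q ≃ range f` via `f`, conjugating the block to `gW|range f`
  set D : Module.End K q := (q.projection p hpq.symm * gV * q.projection p hpq.symm).restrict
      (fun _ _ => Submodule.projection_apply_mem hpq.symm _) with hD
  have hfq : ∀ y : q, f ((q.projection p hpq.symm) (y : V)) = f y := fun y => by
    rw [Submodule.projection_apply_left hpq.symm y]
  -- `f ∘ π_q = f`
  have hfπ : ∀ v : V, f (q.projection p hpq.symm v) = f v := fun v => by
    have h := Submodule.projection_add_projection_eq_self hpq v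
    have hker : f (p.projection q hpq v) = 0 := by
      have hm : p.projection q hpq v ∈ p := Submodule.projection_apply_mem hpq v
      exact LinearMap.mem_ker.mp hm
    conv_rhs => rw [← h]
    rw [map_add, hker, zero_add]
  -- the equivalence `e : q ≃ range f`
  let e₀ : q →ₗ[K] LinearMap.range f := (f ∘ₗ q.subtype).codRestrict (LinearMap.range f) (fun y => ⟨y, rfl⟩)
  have he₀_inj : Function.Injective e₀ := by
    intro y₁ y₂ h
    have h' : f (y₁ : V) = f (y₂ : V) := by
      have := congrArg Subtype.val h
      simpa [e₀] using this
    have hmem : (y₁ : V) - y₂ ∈ p := by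
      rw [hp, LinearMap.mem_ker, map_sub, h', sub_self]
    have hq : (y₁ : V) - y₂ ∈ q := q.sub_mem y₁.2 y₂.2
    have h0 : (y₁ : V) - y₂ = 0 := by
      have := Submodule.disjoint_def.mp hpq.disjoint _ hmem hq
      exact this
    exact Subtype.ext (sub_eq_zero.mp h0)
  have he₀_surj : Function.Surjective e₀ := by
    rintro ⟨w, ⟨v, rfl⟩⟩
    refine ⟨⟨q.projection p hpq.symm v, Submodule.projection_apply_mem hpq.symm v⟩, ?_⟩
    apply Subtype.ext
    simp only [e₀, LinearMap.codRestrict_apply, LinearMap.coe_comp, Submodule.coe_subtype, Function.comp_apply]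
    exact hfπ v
  let e : q ≃ₗ[K] LinearMap.range f := LinearEquiv.ofBijective e₀ ⟨he₀_inj, he₀_surj⟩
  have hconj : e.conj D = gW.restrict (mapsTo_range_of_comp_eq f gV gW hc) := by
    apply LinearMap.ext
    intro w
    obtain ⟨y, rfl⟩ : ∃ y : q, e y = w := e.surjective w
    rw [LinearEquiv.conj_apply, LinearMap.coe_comp, LinearMap.coe_comp, Function.comp_apply, Function.comp_apply,
      LinearEquiv.coe_coe, LinearEquiv.coe_coe, LinearEquiv.symm_apply_apply]
    apply Subtype.ext
    rw [LinearMap.coe_restrict_apply]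
    change ((f ∘ₗ q.subtype) (D y) : W) = gW ((f ∘ₗ q.subtype) y)
    simp only [LinearMap.coe_comp, Submodule.coe_subtype, Function.comp_apply, hD, LinearMap.coe_restrict_apply,
      Module.End.mul_apply]
    rw [hfπ, hcx, hfq]
  rw [← hconj, LinearMap.trace_conj']

/-- PROVED — special case: for a SURJECTIVE intertwiner, `tr gW = tr gV − tr(gV | ker f)`. [folklore] -/
theorem trace_eq_trace_sub_trace_restrict_ker_of_surjective (f : V →ₗ[K] W) (gV : Module.End K V)
    (gW : Module.End K W) (hc : f ∘ₗ gV = gW ∘ₗ f) (hs : Function.Surjective f) :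
    LinearMap.trace K W gW =
      LinearMap.trace K V gV - LinearMap.trace K (LinearMap.ker f) (gV.restrict (mapsTo_ker_of_comp_eq f gV gW hc)) := by
  rw [trace_eq_trace_restrict_ker_add_trace_restrict_range f gV gW hc, add_sub_cancel_left]
  have hr : LinearMap.range f = ⊤ := LinearMap.range_eq_top.mpr hs
  -- trace on `range f = ⊤` is the trace on `W`
  have key : ∀ (r : Submodule K W) (hr' : r = ⊤) (h : ∀ y ∈ r, gW y ∈ r),
      LinearMap.trace K r (gW.restrict h) = LinearMap.trace K W gW := by
    intro r hr' h
    subst hr'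
    exact LinearMap.trace_restrict_eq_of_forall_mem ⊤ gW (fun _ => Submodule.mem_top) h
  exact (key _ hr _).symm

/-! ## §3 Descent: an automorphism swapping two complementary stable subspaces halves the trace -/

/-- PROVED — **DESCENT LEMMA**: if `g` preserves `U`, commutes with the automorphism `φ`, and `V = U ⊕ φ(U)`, then
`tr g = 2 · tr(g|U)` (the `φ(U)`-block of `g` is conjugate to `g|U` by `φ`). Used with `φ = R − R²` on the `ℤ[ω]`-module
`V₁` (PS places) and with the deck ∕ Frobenius involutions (cuspidal places). [folklore] -/
theorem trace_eq_two_mul_trace_restrict_of_isCompl_map (U : Submodule K V) (φ : V ≃ₗ[K] V) (g : Module.End K V)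
    (hU : ∀ x ∈ U, g x ∈ U) (hcomm : ∀ x, g (φ x) = φ (g x))
    (hc : IsCompl U (U.map (φ : V →ₗ[K] V))) :
    LinearMap.trace K V g = 2 * LinearMap.trace K U (g.restrict hU) := by
  set U' : Submodule K V := U.map (φ : V →ₗ[K] V) with hU'
  have hgU' : ∀ x ∈ U', g x ∈ U' := by
    rintro x ⟨u, hu, rfl⟩
    exact ⟨g u, hU u hu, (hcomm u).symm⟩
  rw [trace_eq_trace_block_add_trace_block (U.projection U' hc) g (Submodule.isIdempotentElem_projection hc),
    trace_block_eq_trace_restrict hc g hU, Module.End.one_eq_id, ← Submodule.projection_eq_id_sub_projection hc,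
    trace_block_eq_trace_restrict hc.symm g hgU', two_mul]
  congr 1
  -- `φ|U : U ≃ U'` conjugates `g|U` to `g|U'`
  let e : U ≃ₗ[K] U' := Submodule.equivMapOfInjective (φ : V →ₗ[K] V) φ.injective U
  have hconj : e.conj (g.restrict hU) = g.restrict hgU' := by
    apply LinearMap.ext
    intro w
    obtain ⟨y, rfl⟩ : ∃ y : U, e y = w := e.surjective w
    rw [LinearEquiv.conj_apply, LinearMap.coe_comp, LinearMap.coe_comp, Function.comp_apply, Function.comp_apply,
      LinearEquiv.coe_coe, LinearEquiv.coe_coe, LinearEquiv.symm_apply_apply]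
    apply Subtype.ext
    rw [LinearMap.coe_restrict_apply]
    change ((φ : V →ₗ[K] V) (g.restrict hU y) : V) = g ((φ : V →ₗ[K] V) y)
    simp only [LinearMap.coe_restrict_apply, LinearEquiv.coe_coe]
    exact (hcomm _).symm
  rw [← hconj, LinearMap.trace_conj']

/-! ## §4 The trace of a permutation operator is the number of fixed points -/

/-- PROVED: on `X → K`, the operator `v ↦ v ∘ τ` (`LinearMap.funLeft`) of a permutation `τ` has trace equal to the
number of fixed points of `τ`. [folklore] -/
theorem trace_funLeft_perm {X : Type*} [Fintype X] [DecidableEq X] (τ : Equiv.Perm X) :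
    LinearMap.trace K (X → K) (LinearMap.funLeft K K τ) = ((Finset.univ.filter fun x => τ x = x).card : K) := by
  classical
  rw [LinearMap.trace_eq_matrix_trace K (Pi.basisFun K X)]
  simp only [Matrix.trace, Matrix.diag, LinearMap.toMatrix_apply, Pi.basisFun_repr, Pi.basisFun_apply,
    LinearMap.funLeft_apply, Pi.single_apply]
  rw [Finset.sum_boole]

/-- PROVED: the same for the inverse permutation (fixed points of `τ⁻¹` are those of `τ`), the form in which
`CartanSupply.permAct` acts (`φ ↦ φ ∘ (σ g)⁻¹`). [folklore] -/
theorem trace_funLeft_perm_symm {X : Type*} [Fintype X] [DecidableEq X] (τ : Equiv.Perm X) :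
    LinearMap.trace K (X → K) (LinearMap.funLeft K K τ.symm) = ((Finset.univ.filter fun x => τ x = x).card : K) := by
  rw [trace_funLeft_perm]
  congr 2
  ext x
  simp only [Finset.mem_filter, Finset.mem_univ, true_and]
  constructor
  · intro h
    have := congrArg τ h
    rwa [Equiv.apply_symm_apply, eq_comm] at this
  · intro h
    have := congrArg τ.symm h
    rwa [Equiv.symm_apply_apply, eq_comm] at this

end Field

end Summit.BirchSwinnertonDyer.BirchSwinnertonDyer.Theorems.CartanSupply.TraceTools
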